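import Mathlib
import Literature.MathematicalPhysics.QuantumFieldTheory.Balaban1983to89.B10LogDet63

/-!
# Sketch_ideator1_g6 — crux-ideate `stmt-QuantumFields-19201` (FluctuationComparisonRegPr), seat 1, gen 6
# Card 6 `covariant-two-grid-galerkin`: the FIRST checkable Lean-typed step

The one-loop (Gaussian, "log Z^{(k)} half", [Balaban1985UV3] (61)–(63)) part of the run-K / run-(K+1) discrepancy
of `TwoRunMin` is, cube by cube, a DOUBLE DIFFERENCE of log-determinants: fine grid (spacing h/L, run K+1) at
background `U` minus at `U = 1`, minus the same on the coarse grid (spacing h, run K).  The tree already has the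
single (61)-difference as a resolvent integral (`B10LogDet63.diff61_Ioi`).  This sketch records, kernel-checked:

* §A  the TWO-GRID RESOLVENT DEFECT IDENTITY (the finite-dimensional core of the Fujita–Suzuki / Thomée
  nonsmooth-data estimate): for symmetric `S, T ≥ 0` and `x ≥ 0`,
  `S(1+xS)⁻¹ − T(1+xT)⁻¹ = (1+xS)⁻¹ (S − T) (1+xT)⁻¹`, whence the resolvent two-grid defect is bounded by the
  ELLIPTIC defect `‖S − T‖` uniformly in the spectral parameter (`T = H_f⁻¹`, `S = J H_c⁻¹ Jᵀ`, `J` = covariant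
  prolongation with `JᵀJ = 1`); and the resolvent reading `(x + H)⁻¹ = H⁻¹(1 + xH⁻¹)⁻¹`;
* §B  the double difference as ONE half-line integral of `Tr E⁰(x) − Tr E^U(x)` with the two-grid defect operator
  `E^U(x) := (x + H_f^U)⁻¹ − J (x + H_c^U)⁻¹ Jᵀ` (trace transfer through the isometry `J`), from `diff61_Ioi`;
* §C  the dictionary object `TwoGridDatum` and the consumer-facing rate schema `LocalPlusRate`
  (local `F²` counterterm with an `a = 1` coefficient + an `L^{-σ j}` remainder ⇒ any-`a > 0` decay), with the
  elementary glue proved.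

Nothing here is an estimate on Bałaban's operators: the YM-side content (which tree object is `H_f^U`, the
per-cube localisation, the size `O(h)` of `∫ Tr(E⁰ − E^U)`) is the card's crux list.  No axioms.
-/

noncomputable section

open MeasureTheory Set Matrix

namespace Summit.QuantumFields.YangMills.Cruxes.FluctuationComparisonRegPr.Ideate1TwoGrid

open Literature.MathematicalPhysics.QuantumFieldTheory.Balaban1983to89

/-! ## §A. The two-grid resolvent defect identity -/

section algebra

variable {R : Type*} [CommRing R] {n : Type*} [Fintype n] [DecidableEq n]

/-- Two-grid resolvent defect identity (pure algebra): if `1 + xS` and `1 + xT` are invertible then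
`S(1+xS)⁻¹ − T(1+xT)⁻¹ = (1+xS)⁻¹ (S − T) (1+xT)⁻¹`.  With `T = A⁻¹`, `S = A_h⁻¹P_h` this is the identity behind
the uniform-in-λ resolvent estimate `‖(λ+A_h)⁻¹P_h − (λ+A)⁻¹‖ ≤ ‖A_h⁻¹P_h − A⁻¹‖` (Fujita–Suzuki; Thomée Ch. 3). -/
theorem resolvent_defect_eq (S T : Matrix n n R) (x : R)
    (hS : IsUnit (1 + x • S).det) (hT : IsUnit (1 + x • T).det) :
    S * (1 + x • S)⁻¹ - T * (1 + x • T)⁻¹ = (1 + x • S)⁻¹ * (S - T) * (1 + x • T)⁻¹ := by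
  have hcS : (1 + x • S) * S = S * (1 + x • S) := by
    rw [Matrix.add_mul, Matrix.mul_add, Matrix.one_mul, Matrix.mul_one, Matrix.smul_mul, Matrix.mul_smul]
  have h1 : S * (1 + x • S)⁻¹ = (1 + x • S)⁻¹ * S := by
    calc S * (1 + x • S)⁻¹
        = (1 + x • S)⁻¹ * ((1 + x • S) * S) * (1 + x • S)⁻¹ := by
          rw [Matrix.nonsing_inv_mul_cancel_left (A := 1 + x • S) (B := S) hS]
      _ = (1 + x • S)⁻¹ * (S * (1 + x • S)) * (1 + x • S)⁻¹ := by rw [hcS]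
      _ = (1 + x • S)⁻¹ * S := by
          rw [Matrix.mul_assoc, Matrix.mul_nonsing_inv_cancel_right (A := 1 + x • S) (B := S) hS]
  have h2 : (1 + x • S)⁻¹ * S = (1 + x • S)⁻¹ * (S * (1 + x • T)) * (1 + x • T)⁻¹ := by
    rw [Matrix.mul_assoc ((1 + x • S)⁻¹), Matrix.mul_nonsing_inv_cancel_right (A := 1 + x • T) (B := S) hT]
  have h3 : T * (1 + x • T)⁻¹ = (1 + x • S)⁻¹ * ((1 + x • S) * T) * (1 + x • T)⁻¹ := by
    rw [Matrix.nonsing_inv_mul_cancel_left (A := 1 + x • S) (B := T) hS]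
  rw [h1, h2, h3, ← Matrix.sub_mul, ← Matrix.mul_sub]
  congr 2
  rw [Matrix.mul_add, Matrix.add_mul, Matrix.mul_one, Matrix.one_mul, Matrix.mul_smul, Matrix.smul_mul]
  abel

end algebra

section real

variable {n : Type*} [Fintype n] [DecidableEq n]

theorem isUnit_det_one_add_smul {S : Matrix n n ℝ} (hS : S.PosSemidef) {x : ℝ} (hx : 0 ≤ x) :
    IsUnit (1 + x • S).det :=
  (Matrix.isUnit_iff_isUnit_det _).mp (Matrix.PosDef.one.add_posSemidef (hS.smul hx)).isUnit

/-- The defect identity for real symmetric `S, T ≥ 0` and spectral parameter `x ≥ 0` (no invertibility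
hypotheses left). -/
theorem resolvent_defect_eq_of_posSemidef {S T : Matrix n n ℝ} (hS : S.PosSemidef) (hT : T.PosSemidef)
    {x : ℝ} (hx : 0 ≤ x) :
    S * (1 + x • S)⁻¹ - T * (1 + x • T)⁻¹ = (1 + x • S)⁻¹ * (S - T) * (1 + x • T)⁻¹ :=
  resolvent_defect_eq S T x (isUnit_det_one_add_smul hS hx) (isUnit_det_one_add_smul hT hx)

/-- Resolvent reading: for `H ≻ 0` and `x ≥ 0`, `(x + H)⁻¹ = H⁻¹ (1 + x H⁻¹)⁻¹` — i.e. `T(1+xT)⁻¹` with `T = H⁻¹`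
is the resolvent appearing in `B10LogDet63.diff61_Ioi`. -/
theorem resolvent_eq_inv_mul {H : Matrix n n ℝ} (hH : H.PosDef) {x : ℝ} (hx : 0 ≤ x) :
    (x • (1 : Matrix n n ℝ) + H)⁻¹ = H⁻¹ * (1 + x • H⁻¹)⁻¹ := by
  have hU : IsUnit H.det := (Matrix.isUnit_iff_isUnit_det _).mp hH.isUnit
  have hU' : IsUnit (1 + x • H⁻¹).det := isUnit_det_one_add_smul hH.inv.posSemidef hx
  apply Matrix.inv_eq_right_inv
  rw [← Matrix.mul_assoc, Matrix.add_mul, Matrix.smul_mul, Matrix.one_mul, Matrix.mul_nonsing_inv _ hU,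
    add_comm (x • H⁻¹) 1, Matrix.mul_nonsing_inv _ hU']

end real

/-! ## §B. Trace transfer through the prolongation and the double difference -/

section double

variable {nf nc : Type*} [Fintype nf] [Fintype nc] [DecidableEq nf] [DecidableEq nc]

omit [DecidableEq nf] in
/-- `Tr_f (J M Jᵀ) = Tr_c M` for an isometric prolongation `JᵀJ = 1`. -/
theorem trace_conj_isometry (J : Matrix nf nc ℝ) (hJ : Jᵀ * J = 1) (M : Matrix nc nc ℝ) :
    trace (J * M * Jᵀ) = trace M := by
  rw [Matrix.trace_mul_cycle, hJ, Matrix.one_mul]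

omit [DecidableEq nf] in
/-- Pointwise regrouping of the double-difference integrand into two-grid defects:
`[Tr R_f⁰ − Tr R_f^U] − [Tr R_c⁰ − Tr R_c^U] = Tr(R_f⁰ − J R_c⁰ Jᵀ) − Tr(R_f^U − J R_c^U Jᵀ)`. -/
theorem integrand_regroup (J : Matrix nf nc ℝ) (hJ : Jᵀ * J = 1) (Rf0 Rf Rc0 Rc : _) :
    (trace (Rf0 : Matrix nf nf ℝ) - trace (Rf : Matrix nf nf ℝ))
        - (trace (Rc0 : Matrix nc nc ℝ) - trace (Rc : Matrix nc nc ℝ))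
      = trace (Rf0 - J * Rc0 * Jᵀ) - trace (Rf - J * Rc * Jᵀ) := by
  rw [Matrix.trace_sub, Matrix.trace_sub, trace_conj_isometry J hJ, trace_conj_isometry J hJ]
  ring

/-- The two-grid double difference of log-determinants as ONE half-line resolvent integral
(from the tree's `B10LogDet63.diff61_Ioi`, twice). -/
theorem doubleDiff_eq_integral (F₀ F₁ : Matrix nf nf ℝ) (C₀ C₁ : Matrix nc nc ℝ)
    (hF₀ : F₀.PosDef) (hF₁ : F₁.PosDef) (hC₀ : C₀.PosDef) (hC₁ : C₁.PosDef) :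
    (Real.log F₁.det - Real.log F₀.det) - (Real.log C₁.det - Real.log C₀.det)
      = ∫ x in Ioi (0 : ℝ),
          ((trace ((x • (1 : Matrix nf nf ℝ) + F₀)⁻¹) - trace ((x • (1 : Matrix nf nf ℝ) + F₁)⁻¹))
            - (trace ((x • (1 : Matrix nc nc ℝ) + C₀)⁻¹) - trace ((x • (1 : Matrix nc nc ℝ) + C₁)⁻¹))) := by
  rw [← (B10LogDet63.diff61_Ioi hF₀ hF₁).2, ← (B10LogDet63.diff61_Ioi hC₀ hC₁).2]
  exact (integral_sub (B10LogDet63.diff61_Ioi hF₀ hF₁).1 (B10LogDet63.diff61_Ioi hC₀ hC₁).1).symm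

end double

/-! ## §C. Dictionary object and the consumer-facing rate schema -/

section dictionary

/-- A TWO-GRID DATUM for one RG step at one background: the one-step fluctuation operators on the fine grid
(`Hf` at the background, `Hf0` at `U = 1`) and on the coarse grid (`Hc`, `Hc0`), and the covariant prolongation
`J` (parallel transport by the coarse background along Bałaban's contours), isometric. -/
structure TwoGridDatum (nf nc : Type*) [Fintype nf] [Fintype nc] [DecidableEq nf] [DecidableEq nc] where
  J : Matrix nf nc ℝ
  isometry : Jᵀ * J = 1
  Hf0 : Matrix nf nf ℝ
  Hf : Matrix nf nf ℝ
  Hc0 : Matrix nc nc ℝ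
  Hc : Matrix nc nc ℝ
  hf0 : Hf0.PosDef
  hf : Hf.PosDef
  hc0 : Hc0.PosDef
  hc : Hc.PosDef

variable {nf nc : Type*} [Fintype nf] [Fintype nc] [DecidableEq nf] [DecidableEq nc]

/-- The one-loop run-(K+1)/run-K discrepancy carried by the datum: `[log det Hf − log det Hf0] − [log det Hc − log det Hc0]`. -/
def TwoGridDatum.discrepancy (d : TwoGridDatum nf nc) : ℝ :=
  (Real.log d.Hf.det - Real.log d.Hf0.det) - (Real.log d.Hc.det - Real.log d.Hc0.det)

/-- The two-grid resolvent defect at the background, `E^U(x) = (x + Hf)⁻¹ − J (x + Hc)⁻¹ Jᵀ`. -/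
def TwoGridDatum.defect (d : TwoGridDatum nf nc) (x : ℝ) : Matrix nf nf ℝ :=
  (x • (1 : Matrix nf nf ℝ) + d.Hf)⁻¹ - d.J * (x • (1 : Matrix nc nc ℝ) + d.Hc)⁻¹ * d.Jᵀ

/-- The same at `U = 1`, `E⁰(x)`. -/
def TwoGridDatum.defect0 (d : TwoGridDatum nf nc) (x : ℝ) : Matrix nf nf ℝ :=
  (x • (1 : Matrix nf nf ℝ) + d.Hf0)⁻¹ - d.J * (x • (1 : Matrix nc nc ℝ) + d.Hc0)⁻¹ * d.Jᵀ

/-- **The representation.**  `discrepancy = ∫₀^∞ [Tr E⁰(x) − Tr E^U(x)] dx`. -/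
theorem TwoGridDatum.discrepancy_eq (d : TwoGridDatum nf nc) :
    d.discrepancy = ∫ x in Ioi (0 : ℝ), (trace (d.defect0 x) - trace (d.defect x)) := by
  rw [TwoGridDatum.discrepancy, doubleDiff_eq_integral d.Hf0 d.Hf d.Hc0 d.Hc d.hf0 d.hf d.hc0 d.hc]
  refine setIntegral_congr_fun measurableSet_Ioi fun x _ => ?_
  simp only [TwoGridDatum.defect0, TwoGridDatum.defect]
  exact integrand_regroup d.J d.isometry _ _ _ _

omit [DecidableEq nf] in
/-- `S := J Hc⁻¹ Jᵀ` (the coarse inverse prolonged to the fine grid) is positive semidefinite. -/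
theorem posSemidef_conj (J : Matrix nf nc ℝ) {Hc : Matrix nc nc ℝ} (hHc : Hc.PosDef) :
    (J * Hc⁻¹ * Jᵀ).PosSemidef := by
  simpa only [Matrix.conjTranspose_eq_transpose_of_trivial] using
    hHc.inv.posSemidef.mul_mul_conjTranspose_same J

/-- Push-through identity: `J (x + Hc)⁻¹ Jᵀ = S (1 + x S)⁻¹` with `S = J Hc⁻¹ Jᵀ`, for `JᵀJ = 1`, `Hc ≻ 0`,
`x ≥ 0` — the prolonged coarse resolvent IS the `S`-resolvent of §A. -/
theorem conj_resolvent_eq (J : Matrix nf nc ℝ) (hJ : Jᵀ * J = 1) {Hc : Matrix nc nc ℝ} (hHc : Hc.PosDef)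
    {x : ℝ} (hx : 0 ≤ x) :
    J * (x • (1 : Matrix nc nc ℝ) + Hc)⁻¹ * Jᵀ
      = (J * Hc⁻¹ * Jᵀ) * (1 + x • (J * Hc⁻¹ * Jᵀ))⁻¹ := by
  have hUc' : IsUnit (1 + x • Hc⁻¹).det := isUnit_det_one_add_smul hHc.inv.posSemidef hx
  have hUS : IsUnit (1 + x • (J * Hc⁻¹ * Jᵀ)).det := isUnit_det_one_add_smul (posSemidef_conj J hHc) hx
  have hRx1 : (x • (1 : Matrix nc nc ℝ) + Hc)⁻¹ * (1 + x • Hc⁻¹) = Hc⁻¹ := by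
    rw [resolvent_eq_inv_mul hHc hx,
      Matrix.nonsing_inv_mul_cancel_right (A := 1 + x • Hc⁻¹) (B := Hc⁻¹) hUc']
  have haux : J * (x • (1 : Matrix nc nc ℝ) + Hc)⁻¹ * Jᵀ * (J * Hc⁻¹ * Jᵀ)
      = J * ((x • (1 : Matrix nc nc ℝ) + Hc)⁻¹ * Hc⁻¹) * Jᵀ := by
    simp only [Matrix.mul_assoc]
    rw [← Matrix.mul_assoc Jᵀ J _, hJ, Matrix.one_mul]
  have key : J * (x • (1 : Matrix nc nc ℝ) + Hc)⁻¹ * Jᵀ * (1 + x • (J * Hc⁻¹ * Jᵀ))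
      = J * ((x • (1 : Matrix nc nc ℝ) + Hc)⁻¹ * (1 + x • Hc⁻¹)) * Jᵀ := by
    rw [Matrix.mul_add, Matrix.mul_one, Matrix.mul_smul, haux]
    rw [Matrix.mul_add, Matrix.mul_one, Matrix.mul_smul, Matrix.mul_add, Matrix.add_mul, Matrix.mul_smul,
      Matrix.smul_mul]
  calc J * (x • (1 : Matrix nc nc ℝ) + Hc)⁻¹ * Jᵀ
      = J * (x • (1 : Matrix nc nc ℝ) + Hc)⁻¹ * Jᵀ * (1 + x • (J * Hc⁻¹ * Jᵀ))
          * (1 + x • (J * Hc⁻¹ * Jᵀ))⁻¹ := by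
        rw [Matrix.mul_nonsing_inv_cancel_right (A := 1 + x • (J * Hc⁻¹ * Jᵀ))
          (B := J * (x • (1 : Matrix nc nc ℝ) + Hc)⁻¹ * Jᵀ) hUS]
    _ = (J * Hc⁻¹ * Jᵀ) * (1 + x • (J * Hc⁻¹ * Jᵀ))⁻¹ := by rw [key, hRx1]

/-- **The factorised defect** (the ENGINE in finite dimensions): with `T = Hf⁻¹`, `S = J Hc⁻¹ Jᵀ`,
`E^U(x) = −(1 + xS)⁻¹ (S − T) (1 + xT)⁻¹`; hence `‖E^U(x)‖ ≤ ‖S − T‖ =` the ELLIPTIC two-grid defect, uniformly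
in `x ≥ 0` (both outer factors are contractions since `S, T ≥ 0`). -/
theorem TwoGridDatum.defect_eq (d : TwoGridDatum nf nc) {x : ℝ} (hx : 0 ≤ x) :
    d.defect x = -((1 + x • (d.J * d.Hc⁻¹ * d.Jᵀ))⁻¹ * (d.J * d.Hc⁻¹ * d.Jᵀ - d.Hf⁻¹) * (1 + x • d.Hf⁻¹)⁻¹) := by
  rw [TwoGridDatum.defect, resolvent_eq_inv_mul d.hf hx, conj_resolvent_eq d.J d.isometry d.hc hx,
    ← resolvent_defect_eq_of_posSemidef (posSemidef_conj d.J d.hc) d.hf.inv.posSemidef hx]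
  exact (neg_sub _ _).symm

end dictionary

section rate

variable {V : Type*}

/-- **Consumer-facing rate schema** (what card 6 promises the `TwoRunMin` consumer, any `a > 0` sufficing):
along the depth `j` (fine spacing `L^{-j}` under the unit lattice) the per-cube discrepancy `disc j v` at
background `v` is a LOCAL counterterm `δβ j · A v` (`A` = the local `F²` density functional, `|δβ j| ≤ C L^{-j}`:
the `a = 1` channel of FINDING N6) plus a remainder `≤ C L^{-σ j} (1 + A v)` (the two-grid Galerkin rate). -/
def LocalPlusRate (L : ℕ) (disc : ℕ → V → ℝ) (A : V → ℝ) (σ : ℝ) : Prop :=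
  ∃ C : ℝ, 0 ≤ C ∧ ∃ δβ : ℕ → ℝ, (∀ j, |δβ j| ≤ C * (L : ℝ) ^ (-(j : ℝ))) ∧
    ∀ j v, |disc j v - δβ j * A v| ≤ C * (L : ℝ) ^ (-(σ * j)) * (1 + A v)

/-- Any-`a > 0` decay (the form the consumer needs): `|disc j v| ≤ C' (1 + A v) L^{-a j}`. -/
def DecayAt (L : ℕ) (disc : ℕ → V → ℝ) (A : V → ℝ) (a : ℝ) : Prop :=
  ∃ C : ℝ, 0 ≤ C ∧ ∀ j v, |disc j v| ≤ C * (1 + A v) * (L : ℝ) ^ (-(a * j))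

/-- Glue: `LocalPlusRate σ ⇒ DecayAt (min 1 σ)` for `L ≥ 1` and a non-negative density `A`. -/
theorem decayAt_of_localPlusRate {L : ℕ} (hL : 1 ≤ L) {disc : ℕ → V → ℝ} {A : V → ℝ} (hA : ∀ v, 0 ≤ A v)
    {σ : ℝ} (h : LocalPlusRate L disc A σ) : DecayAt L disc A (min 1 σ) := by
  obtain ⟨C, hC, δβ, hδ, hR⟩ := h
  refine ⟨2 * C, by positivity, fun j v => ?_⟩
  have hL' : (1 : ℝ) ≤ (L : ℝ) := by exact_mod_cast hL
  have hj : (0 : ℝ) ≤ (j : ℝ) := Nat.cast_nonneg j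
  have hm1 : min 1 σ ≤ 1 := min_le_left _ _
  have hmσ : min 1 σ ≤ σ := min_le_right _ _
  -- monotonicity of `L^{-e j}` in the exponent rate `e`
  have hpow1 : (L : ℝ) ^ (-(j : ℝ)) ≤ (L : ℝ) ^ (-(min 1 σ * j)) := by
    apply Real.rpow_le_rpow_of_exponent_le hL'
    nlinarith
  have hpowσ : (L : ℝ) ^ (-(σ * j)) ≤ (L : ℝ) ^ (-(min 1 σ * j)) := by
    apply Real.rpow_le_rpow_of_exponent_le hL'
    nlinarith
  have hP : 0 ≤ (L : ℝ) ^ (-(min 1 σ * j)) := Real.rpow_nonneg (by positivity) _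
  have h1 : |disc j v| ≤ |disc j v - δβ j * A v| + |δβ j * A v| := by
    have := abs_add_le (disc j v - δβ j * A v) (δβ j * A v)
    simpa using this
  have h2 : |δβ j * A v| ≤ C * (L : ℝ) ^ (-(min 1 σ * j)) * A v := by
    rw [abs_mul, abs_of_nonneg (hA v)]
    exact mul_le_mul_of_nonneg_right ((hδ j).trans (mul_le_mul_of_nonneg_left hpow1 hC)) (hA v)
  have h3 : |disc j v - δβ j * A v| ≤ C * (L : ℝ) ^ (-(min 1 σ * j)) * (1 + A v) :=
    (hR j v).trans (mul_le_mul_of_nonneg_right (mul_le_mul_of_nonneg_left hpowσ hC) (by linarith [hA v]))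
  have hAv := hA v
  calc |disc j v| ≤ C * (L : ℝ) ^ (-(min 1 σ * j)) * (1 + A v) + C * (L : ℝ) ^ (-(min 1 σ * j)) * A v :=
        h1.trans (add_le_add h3 h2)
    _ ≤ 2 * C * (1 + A v) * (L : ℝ) ^ (-(min 1 σ * j)) := by nlinarith [mul_nonneg hC hP, mul_nonneg (mul_nonneg hC hP) hAv]

end rate

end Summit.QuantumFields.YangMills.Cruxes.FluctuationComparisonRegPr.Ideate1TwoGrid
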